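import Summits.ABC.IUTFork.Repair.RHCellSlackExact
import Summits.ABC.IUTFork.Repair.RHCreditShellBudgetMixed
import Summits.ABC.IUTFork.Repair.RHReachLedgerRealise
import Summits.ABC.IUTFork.Cor312HullVolumePrVolScaled
import HarnessLib

/-!
# D-0121 Q1 (T-OPTIMALITY), R33(4) — THE GLOBAL FORM AT THE SHARP SETTING OF RECORD: the cell slack `σ_{i+1,p}` of
# `settingPrVolSharp` is at most `Σ_{v⃗} Pr(v⃗)·(1 + Σ_a (D + R_in − R_out)(v_a)/e(v_a) + transfer(v⃗))·log p`, and — when every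
# Θ-slot is at least as deep as its tuple's `q`-slot — at most `(1 + (j+1)·Σ_{v ∣ p} Pr(v)·(D_v + R_in,v − R_out,v)/e_v)·log p`

PROOF-ONLY file (0 definitions, 0 `Prop` facts, no instance, no notation) of the abc-iut cell, rung LADDER-ABC:A2.RESCUE.H, seat
abc-iut-rh2-T-1 (gen 4). The «GLOBAL sum» that `Repair/RHCreditShellBudget.lean` (p491053) and its referees (abc-iut-rh2-exp-ref
03:28:08Z, abc-iut-rh2-ref-3 03:28:51Z) recorded as NOT TYPED: composition BY NAME of
* abc-iut-rh-typ-4's identity `Repair/RHCellSlackExact.cellSlack_settingPrVolSharp_eq` (p481438 §3):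
  `logvol(ⁿ˒°𝒰_{i+1,p}) − qLocal_{i+1,p} = Σ_{v⃗} Pr(v⃗)·(−m(v⃗)·log p + Σ_a log‖c^out(v_a)‖ − log‖t_{q,v_{i+1}}‖)` at the packet-normalised
  sharp real setting `Thm311.Real.settingPrVolSharp X …` (EVERY pilot data `X` over any number field, any non-zero Θ-ideles `t` and
  `q`-ideles `tq`, exact contents `m(v⃗)` as the binder pair `hm0`/`hm1`, outer-radius binders `cout`/`houtΛ`/`hdom`);
* this seat's per-tuple bound `Repair/RHCreditShellBudgetMixed` (p493746) in BRACKET form (§1 below, general family `k : I → Type`):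
  `−m·log p + Σ_a log‖c^out_a‖ − log‖t_q‖ ≤ (1 + Σ_a (D_a + R_in,a − R_out,a)/e_a + (m_q/e_{b′} − μ))·log p` for any `μ ≤ M_a/e_a`;
* the probability-weight bookkeeping of abc-iut-c312-1, -c312-3, -c312-7 (`weightPr = ∏_a Pr(v_a)`, `Σ_{v⃗} Pr(v⃗) = 1`: `sum_weightPr_presAt`;
  coordinate marginals: abc-iut-rh-typ-10's `RH.ReachLedgerRealise.sum_weightPr_mul_apply_last` + `weightPr_perm`).

WHAT IS TYPED (namespace `Summit.ABC.IUTFork.Repair.RHCreditShellBudgetSetting`).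
* §1 `bracket_le_shellBudget_add_transfer` — the bracket form of p493746's `cellSlack_le_shellBudget_add_transfer` (uses only the
  maximality half `hm1` of the exact content).
* §2 `sum_weightPr_mul_apply_coord` — **ANY-SLOT MARGINAL** `Σ_{v⃗} Pr_j(v⃗)·g(v_a) = Σ_{v ∣ p} (n_v/[F:ℚ])·g(v)` for every slot `a` (the
  last-slot marginal transported along the transposition `(a last)`, `weightPr_perm`); `sum_weightPr_mul_sum_apply` —
  `Σ_{v⃗} Pr_j(v⃗)·Σ_a g(v_a) = |S^±_{j+1}|·Σ_{v ∣ p} (n_v/[F:ℚ])·g(v)`.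
* §3 AT THE SETTING. Per place `x` over `p` of the field `F` of the pilot data: a norm uniformiser `ϖ_x` of the completion
  `(presAt X hlog p).k x`, the different exponent `D_x`, inner/outer radii `‖c_in,x‖ = ‖ϖ_x‖^{R_in,x}`, `‖c_out,x‖ = ‖ϖ_x‖^{R_out,x}` of
  `log_p(𝒪^×)`, the Θ-depth `‖t_{i,x}‖ = ‖ϖ_x‖^{M_x}` and the `q`-depth `‖t_{q,x}‖ = ‖ϖ_x‖^{m_{q,x}}` (binders; which genuine datum carries which
  integers is the kit tables' audit — computed ≠ proved):
  **`cellSlack_settingPrVolSharp_le_sum_shellBudget_add_transfer`** — for ANY per-tuple lower bounds `μ(v⃗) ≤ M_{v_a}/e_{v_a}`: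
  `σ_{i+1,p} ≤ Σ_{v⃗} Pr(v⃗)·(1 + Σ_a (D + R_in − R_out)(v_a)/e(v_a) + (m_{q,v_{i+1}}/e_{v_{i+1}} − μ(v⃗)))·log p`;
  **`cellSlack_settingPrVolSharp_le_sum_shellBudget_of_deep`** — if every Θ-slot of every tuple is at least as deep as the tuple's `q`-slot
  (`m_{q,v_{i+1}}/e_{v_{i+1}} ≤ M_{v_a}/e_{v_a}`; e.g. all places of `F` over `p` Galois-conjugate with equal pilot orders, `M = (i+1)²·m_q`):
  `σ_{i+1,p} ≤ Σ_{v⃗} Pr(v⃗)·(1 + Σ_a (D + R_in − R_out)(v_a)/e(v_a))·log p`;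
  **`cellSlack_settingPrVolSharp_le_shellBudget_places_of_deep`** — THE PLACE-LEVEL (GLOBAL) FORM:
  `σ_{i+1,p} ≤ (1 + |S^±_{i+2}|·Σ_{v ∣ p} (n_v/[F:ℚ])·(D_v + R_in,v − R_out,v)/e_v)·log p` — different + log-shell, `(j+1)` slots, one floor
  loss; NO local height. Summed over the bad primes with the procession normalisation this is the datum-level «credit ≤ conductor-type budget»
  of D-0121 R33(4) / R38(b) for data meeting the deep-slot condition; for the other data the transfer terms of the first theorem are the
  (HEIGHT-type) correction, tuple by tuple.

HONEST FRAMING: identities and inequalities between OUR typed objects at ONE instantiation (the sharp real setting of record) with prescribed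
per-place integer binders; the link integers ↔ genuine datum is the kit certificate; nothing here decides any cell at genuine data, asserts or
denies [IUTchIII] Cor. 3.12, or bears on abc; no side taken on any author (Mochizuki / Scholze–Stix / Joshi / Dupuy–Hilado); typed ≠ proved for
anything not named as a theorem; instantiated ≠ endorsed. [claim: Mochizuki2012, status: disputed] for every quoted construction.
[cite: DupuyHilado2025, §3.6, §3.7, §3.9, §4.9, §4.12, Thm. 3.10.1 proof] [cite: Mochizuki2012, IUTchIII Cor. 3.12 p. 173–175; IUTchIV Prop. 1.2
(i)(ii) p. 10, Prop. 1.4 (iii) p. 13–14, Thm. 1.10 Step (v) p. 27–28; IUTchI Rmk. 3.1.5 p. 65] [cite: NeukirchANT1999, Ch. II (5.5)]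
-/

noncomputable section

open Set Function NumberField IsDedekindDomain
open scoped Pointwise

namespace Summit.ABC.IUTFork.Repair.RHCreditShellBudgetSetting

open Thm311 Thm311.Real Cor312 Cor312Vol Literature.IUT.LogThetaLattice Literature.IUT.LogVolume
  Literature.NumberTheory.GaloisRepresentations.Ultrametric Summit.ABC.IUTFork.Repair.RHCreditShellBudgetMixed

/-! ## §1. The bracket form of the per-tuple bound (general family) -/

section General

variable (p : ℕ) [Fact p.Prime] {I : Type} [Fintype I] [DecidableEq I] [Nonempty I]
  (k : I → Type) [∀ i, NontriviallyNormedField (k i)] [∀ i, NormedAlgebra ℚ_[p] (k i)]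
  [∀ i, IsUltrametricDist (k i)] [∀ i, ProperSpace (k i)]

/-- **BRACKET FORM of p493746's `cellSlack_le_shellBudget_add_transfer`.** Norm uniformisers `ϖ_i`, different exponents `D_i`, inner radii
`‖c_in,i‖ = ‖ϖ_i‖^{R_in,i}` (largest balls in `log_p(𝒪^×_{k_i})`), ANY elements `c_out,i` with `‖c_out,i‖ = ‖ϖ_i‖^{R_out,i}`, Θ-slot scalars
`‖x_a‖ = ‖ϖ_a‖^{M_a}`, `‖t_q‖ = ‖ϖ_{b′}‖^{m_q}`, an integer `m` such that the slot union is NOT in `p^{m+1}·log_p(R_I^×)` (maximality half of the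
exact content), and ANY real `μ ≤ M_a/e_a` (all `a`):
`−m·log p + Σ_i log‖c_out,i‖ − log‖t_q‖ ≤ (1 + Σ_i (D_i + (R_in,i − R_out,i))/e_i + (m_q/e_{b′} − μ))·log p`.
[cite: DupuyHilado2025, §4.9, §4.12] [cite: Mochizuki2012, IUTchIV Prop. 1.2 (i)(ii) p. 10] [claim: Mochizuki2012, status: disputed] -/
theorem bracket_le_shellBudget_add_transfer (ϖ : Π i, (k i)ˣ) (hϖ : ∀ i, IsUniformizer (ϖ i))
    {D : I → ℕ} (hD : ∀ i, differentOrd p (k i) = (D i : ℝ) / absRamificationIdx p (k i))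
    {cin cout : Π i, k i} (hin : ∀ i (o : k i), ‖o‖ ≤ 1 → cin i * o ∈ logUnits (k i))
    (hmax : ∀ i, ∃ (ϖ' : (k i)ˣ) (w : k i), IsUniformizer ϖ' ∧ w ∉ logUnits (k i) ∧ ‖w‖ * ‖(ϖ' : k i)‖ ≤ ‖cin i‖)
    {Rin Rout : I → ℤ} (hRin : ∀ i, ‖cin i‖ = ‖(ϖ i : k i)‖ ^ Rin i) (hRout : ∀ i, ‖cout i‖ = ‖(ϖ i : k i)‖ ^ Rout i)
    {x : Π i, k i} {M : I → ℤ} (hx : ∀ a, ‖x a‖ = ‖(ϖ a : k a)‖ ^ M a) {m : ℤ}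
    (hm1 : ¬ (⋃ a, iota p k a (x a) • (normalizedPacket p k : Set (PacketAlgebra p k))) ⊆
      ((p : ℚ_[p]) ^ (m + 1)) • (logPacket p k : Set (PacketAlgebra p k)))
    (b' : I) {tq : k b'} {mq : ℤ} (hq : ‖tq‖ = ‖(ϖ b' : k b')‖ ^ mq)
    {μ : ℝ} (hμ : ∀ a, μ ≤ (M a : ℝ) / absRamificationIdx p (k a)) :
    -((m : ℝ) * Real.log p) + ∑ i, Real.log ‖cout i‖ - Real.log ‖tq‖ ≤
      (1 + ∑ i, ((D i : ℝ) + (Rin i - Rout i)) / absRamificationIdx p (k i) +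
          ((mq : ℝ) / absRamificationIdx p (k b') - μ)) * Real.log p := by
  have hp1 : (1 : ℝ) < p := by exact_mod_cast (Fact.out : p.Prime).one_lt
  have hp0 : (0 : ℝ) < p := by linarith
  have hlog : 0 < Real.log p := Real.log_pos hp1
  -- the crude admissible content `⌊μ − Σ (D + R_in)/e⌋` is `≤ m`
  set S : ℝ := ∑ i, ((D i : ℝ) + Rin i) / absRamificationIdx p (k i) with hS
  have hadm := slotUnion_subset_zpow_smul_logPacket_of_orders p k ϖ hϖ hD hin hmax hRin hx (m' := ⌊μ - S⌋) fun a => by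
    have h1 : ((⌊μ - S⌋ : ℤ) : ℝ) ≤ μ - S := Int.floor_le _
    linarith [hμ a]
  have hle : ⌊μ - S⌋ ≤ m := le_content_of_subset p k hm1 hadm
  have hm_lb : μ - S - 1 < (m : ℝ) := by
    have h1 : μ - S < ((⌊μ - S⌋ : ℤ) : ℝ) + 1 := Int.lt_floor_add_one _
    have h2 : ((⌊μ - S⌋ : ℤ) : ℝ) ≤ (m : ℝ) := by exact_mod_cast hle
    linarith
  -- the bracket in orders
  have hlogc : ∀ i, Real.log ‖cout i‖ = -((Rout i : ℝ) / absRamificationIdx p (k i)) * Real.log p := fun i => by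
    rw [hRout i, Thm311.Real.norm_unif_zpow_eq_rpow p (hϖ i), Real.log_rpow hp0]
  have hlogq : Real.log ‖tq‖ = -((mq : ℝ) / absRamificationIdx p (k b')) * Real.log p := by
    rw [hq, Thm311.Real.norm_unif_zpow_eq_rpow p (hϖ b'), Real.log_rpow hp0]
  have hbr : -((m : ℝ) * Real.log p) + ∑ i, Real.log ‖cout i‖ - Real.log ‖tq‖ =
      (-(m : ℝ) - ∑ i, (Rout i : ℝ) / absRamificationIdx p (k i) + (mq : ℝ) / absRamificationIdx p (k b')) * Real.log p := by
    rw [Finset.sum_congr rfl fun i _ => hlogc i, ← Finset.sum_mul, Finset.sum_neg_distrib, hlogq]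
    ring
  rw [hbr]
  refine mul_le_mul_of_nonneg_right ?_ hlog.le
  have hsplit : ∑ i, ((D i : ℝ) + (Rin i - Rout i)) / absRamificationIdx p (k i) =
      S - ∑ i, (Rout i : ℝ) / absRamificationIdx p (k i) := by
    rw [hS, ← Finset.sum_sub_distrib]
    exact Finset.sum_congr rfl fun i _ => by ring
  rw [hsplit]
  linarith

end General

/-! ## §2. Coordinate marginals of the probability weights -/

section Marginals

variable {F : Type} [Field F] [NumberField F] (X : PilotData F) {logv : PadicLogs F} (hlog : LogvAnalytic logv)

/-- **ANY-SLOT MARGINAL**: `Σ_{v⃗} Pr_j(v⃗)·g(v_a) = Σ_{v ∣ p} (n_v/[F:ℚ])·g(v)` for every slot `a` of the `(j+1)`-packet over `p` and every real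
`g` on the fibre — abc-iut-rh-typ-10's last-slot marginal `RH.ReachLedgerRealise.sum_weightPr_mul_apply_last` transported along the
transposition `(a last)` of the slots (`weightPr_perm`: `Pr_j` is a symmetric product weight). [cite: DupuyHilado2025, §3.6, Thm. 3.10.1 proof] -/
theorem sum_weightPr_mul_apply_coord (pp : Nat.Primes) (j : (thetaIndex X).Label) (a : (thetaIndex X).Caps j)
    (g : (thetaIndex X).Fibre (.inr pp) → ℝ) :
    haveI : Fact (pp : ℕ).Prime := ⟨pp.2⟩
    ∑ e : (presAt X hlog pp).toLocalPieces.E j, weightPr X pp.1 j e * g (e a) =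
      ∑ v : ↥(placesOver F pp), weight F v.1 * g ((fibreEquivPlacesOver X pp).symm v) := by
  haveI : Fact (pp : ℕ).Prime := ⟨pp.2⟩
  rw [← RH.ReachLedgerRealise.sum_weightPr_mul_apply_last X hlog pp j g]
  -- re-index the tuples along the transposition `(a last)` (abc-iut-c312-3's `tupleReindex`, `v⃗ ↦ v⃗ ∘ σ`)
  set σ : Equiv.Perm ((thetaIndex X).Caps j) := Equiv.swap a (Fin.last _) with hσ
  set ρ : (presAt X hlog pp).toLocalPieces.E j ≃ (presAt X hlog pp).toLocalPieces.E j :=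
    PadicPresentation.tupleReindex (T := thetaIndex X) (.inr pp) σ
  have hρe : ∀ e : (presAt X hlog pp).toLocalPieces.E j, ρ e = e ∘ ⇑σ := fun e => rfl
  calc ∑ e : (presAt X hlog pp).toLocalPieces.E j, weightPr X pp.1 j e * g (e a)
      = ∑ e : (presAt X hlog pp).toLocalPieces.E j, weightPr X pp.1 j (ρ e) * g ((ρ e) (Fin.last _)) :=
        Finset.sum_congr rfl fun e _ => by
          have hw : weightPr X pp.1 j (ρ e) = weightPr X pp.1 j e := weightPr_perm X pp.1 j σ e
          have hlast : (ρ e) (Fin.last _) = e a := by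
            rw [hρe e, Function.comp_apply, hσ, Equiv.swap_apply_right]
          rw [hw, hlast]
    _ = ∑ e : (presAt X hlog pp).toLocalPieces.E j, weightPr X pp.1 j e * g (e (Fin.last _)) :=
        Equiv.sum_comp ρ (fun e => weightPr X pp.1 j e * g (e (Fin.last _)))

/-- **`Σ_{v⃗} Pr_j(v⃗)·Σ_a g(v_a) = |S^±_{j+1}|·Σ_{v ∣ p} (n_v/[F:ℚ])·g(v)`** (the any-slot marginal summed over the slots).
[cite: DupuyHilado2025, §3.6, Thm. 3.10.1 proof] -/
theorem sum_weightPr_mul_sum_apply (pp : Nat.Primes) (j : (thetaIndex X).Label) (g : (thetaIndex X).Fibre (.inr pp) → ℝ) :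
    haveI : Fact (pp : ℕ).Prime := ⟨pp.2⟩
    ∑ e : (presAt X hlog pp).toLocalPieces.E j, weightPr X pp.1 j e * ∑ a, g (e a) =
      Fintype.card ((thetaIndex X).Caps j) * ∑ v : ↥(placesOver F pp), weight F v.1 * g ((fibreEquivPlacesOver X pp).symm v) := by
  haveI : Fact (pp : ℕ).Prime := ⟨pp.2⟩
  have h1 : ∀ e : (presAt X hlog pp).toLocalPieces.E j,
      weightPr X pp.1 j e * ∑ a, g (e a) = ∑ a, weightPr X pp.1 j e * g (e a) := fun e => Finset.mul_sum _ _ _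
  rw [Finset.sum_congr rfl fun e _ => h1 e, Finset.sum_comm,
    Finset.sum_congr rfl fun a _ => sum_weightPr_mul_apply_coord X hlog pp j a g, Finset.sum_const, Finset.card_univ,
    nsmul_eq_mul]

end Marginals

/-! ## §3. At the sharp real setting of record -/

section Setting

variable {F : Type} [Field F] [NumberField F] (X : PilotData F) {logv : PadicLogs F} (hlog : LogvAnalytic logv)
  (M : Type) [Field M] [NumberField M]
  (archPk : ∀ (j : (thetaIndex X).Label) (vQ : (thetaIndex X).VQ), Set ((logShellsDH X logv).Packet j vQ))
  (archSub : ∀ (j : (thetaIndex X).Label) (v : (thetaIndex X).V),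
    Set ((logShellsDH X logv).Packet j ((thetaIndex X).over v)))
  (Ψ : ℤ → ∀ v : (thetaIndex X).V, v ∈ (thetaIndex X).Vbad → Set ((logShellsDH X logv).StarPacket v))
  (act : ℤ → ∀ v : (thetaIndex X).V, v ∈ (thetaIndex X).Vbad →
    (logShellsDH X logv).StarPacket v → Module.End ℚ ((logShellsDH X logv).StarPacket v))
  (Mmod : ℤ → ∀ j : (thetaIndex X).LabelStar, Set ((logShellsDH X logv).GlobalPacket j.1))
  (region : ℤ → ∀ j : (thetaIndex X).LabelStar, FinDivisor M → ∀ vQ : (thetaIndex X).VQ,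
    Set ((logShellsDH X logv).Packet j.1 vQ))
  (n : ℤ) {HT : Type} {LogLink : HT → HT → Type} {IsFull : ∀ {s t : HT}, LogLink s t → Prop}
  (lat : LGPGaussianLogThetaLattice LogLink IsFull)
  {Frd : Type} {IsoF : Frd → Frd → Type} {Ob : Frd → Type} {realify : Frd → Frd} {Strip : Type}
  {IsoS : Strip → Strip → Type} {Mv : ∀ v : (thetaIndex X).V, v ∈ (thetaIndex X).Vbad → Type}
  [∀ v h, Monoid (Mv v h)]
  (sig : GlobalLGPFrobenioidSignature (thetaIndex X).lstar (thetaIndex X).V (· ∈ (thetaIndex X).Vbad)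
    Frd IsoF Ob realify Strip IsoS Mv)
  (split : SplittingMonoids Mv) {ObΔ : Type} {N : ∀ v : (thetaIndex X).V, v ∈ (thetaIndex X).Vbad → Type}
  [∀ v h, Monoid (N v h)] (qData : QPilotData ObΔ N)
  (t : ∀ (pp : Nat.Primes) (_ : Fin X.lstar) (x : (thetaIndex X).Fibre (.inr pp)),
    haveI : Fact (pp : ℕ).Prime := ⟨pp.2⟩; kOf X pp.1 x)
  (tq : ∀ (pp : Nat.Primes) (x : (thetaIndex X).Fibre (.inr pp)), haveI : Fact (pp : ℕ).Prime := ⟨pp.2⟩; kOf X pp.1 x)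
  (ht0 : ∀ pp i x, t pp i x ≠ 0)
  (ht1 : ∀ (pp : Nat.Primes) (i : Fin X.lstar) (x : (thetaIndex X).Fibre (.inr pp)),
    haveI : Fact (pp : ℕ).Prime := ⟨pp.2⟩; placeOf X pp.1 x ∉ X.S → ‖t pp i x‖ = 1)
  (htq0 : ∀ pp x, tq pp x ≠ 0)
  (htq1 : ∀ (pp : Nat.Primes) (x : (thetaIndex X).Fibre (.inr pp)),
    haveI : Fact (pp : ℕ).Prime := ⟨pp.2⟩; placeOf X pp.1 x ∉ X.S → ‖tq pp x‖ = 1)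
  (i : Fin (thetaIndex X).lstar) (pp : Nat.Primes)
  /- the EXACT content family of the slot unions over `p` (p481438's binders) -/
  (m : ((thetaIndex X).Caps (Setting.labelSucc i) → (thetaIndex X).Fibre (.inr pp)) → ℤ)
  (hm0 : ∀ e : (thetaIndex X).Caps (Setting.labelSucc i) → (thetaIndex X).Fibre (.inr pp),
    haveI : Fact (pp : ℕ).Prime := ⟨pp.2⟩
    (⋃ a, iota pp.1 ((presAt X hlog pp).kk e) a (t pp i (e a)) •
        (normalizedPacket pp.1 ((presAt X hlog pp).kk e) : Set ((presAt X hlog pp).X e))) ⊆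
      (((pp : ℕ) : ℚ_[pp]) ^ m e) • (logPacket pp.1 ((presAt X hlog pp).kk e) : Set ((presAt X hlog pp).X e)))
  (hm1 : ∀ e : (thetaIndex X).Caps (Setting.labelSucc i) → (thetaIndex X).Fibre (.inr pp),
    haveI : Fact (pp : ℕ).Prime := ⟨pp.2⟩
    ¬ (⋃ a, iota pp.1 ((presAt X hlog pp).kk e) a (t pp i (e a)) •
        (normalizedPacket pp.1 ((presAt X hlog pp).kk e) : Set ((presAt X hlog pp).X e))) ⊆
      (((pp : ℕ) : ℚ_[pp]) ^ (m e + 1)) • (logPacket pp.1 ((presAt X hlog pp).kk e) : Set ((presAt X hlog pp).X e)))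
  /- per-place binders over `p`: uniformiser, different exponent, inner/outer radius elements and exponents, Θ- and q-depths -/
  (ϖ : ∀ x : (thetaIndex X).Fibre (.inr pp), haveI : Fact (pp : ℕ).Prime := ⟨pp.2⟩; ((presAt X hlog pp).k x)ˣ)
  (hϖ : ∀ x, haveI : Fact (pp : ℕ).Prime := ⟨pp.2⟩; IsUniformizer (ϖ x))
  {D : (thetaIndex X).Fibre (.inr pp) → ℕ}
  (hD : ∀ x, haveI : Fact (pp : ℕ).Prime := ⟨pp.2⟩;
    differentOrd pp.1 ((presAt X hlog pp).k x) = (D x : ℝ) / absRamificationIdx pp.1 ((presAt X hlog pp).k x))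
  {cin cout : ∀ x : (thetaIndex X).Fibre (.inr pp), haveI : Fact (pp : ℕ).Prime := ⟨pp.2⟩; (presAt X hlog pp).k x}
  (hin : ∀ x, haveI : Fact (pp : ℕ).Prime := ⟨pp.2⟩;
    ∀ o : (presAt X hlog pp).k x, ‖o‖ ≤ 1 → cin x * o ∈ logUnits ((presAt X hlog pp).k x))
  (hmax : ∀ x, haveI : Fact (pp : ℕ).Prime := ⟨pp.2⟩;
    ∃ (ϖ' : ((presAt X hlog pp).k x)ˣ) (w : (presAt X hlog pp).k x),
      IsUniformizer ϖ' ∧ w ∉ logUnits ((presAt X hlog pp).k x) ∧ ‖w‖ * ‖(ϖ' : (presAt X hlog pp).k x)‖ ≤ ‖cin x‖)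
  (houtΛ : ∀ x, haveI : Fact (pp : ℕ).Prime := ⟨pp.2⟩; cout x ∈ logUnits ((presAt X hlog pp).k x))
  (hdom : ∀ x, haveI : Fact (pp : ℕ).Prime := ⟨pp.2⟩; ∀ z ∈ logUnits ((presAt X hlog pp).k x), ‖z‖ ≤ ‖cout x‖)
  {Rin Rout : (thetaIndex X).Fibre (.inr pp) → ℤ}
  (hRin : ∀ x, haveI : Fact (pp : ℕ).Prime := ⟨pp.2⟩; ‖cin x‖ = ‖(ϖ x : (presAt X hlog pp).k x)‖ ^ Rin x)
  (hRout : ∀ x, haveI : Fact (pp : ℕ).Prime := ⟨pp.2⟩; ‖cout x‖ = ‖(ϖ x : (presAt X hlog pp).k x)‖ ^ Rout x)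
  {MΘ mq : (thetaIndex X).Fibre (.inr pp) → ℤ}
  (hMΘ : ∀ x, haveI : Fact (pp : ℕ).Prime := ⟨pp.2⟩; ‖t pp i x‖ = ‖(ϖ x : (presAt X hlog pp).k x)‖ ^ MΘ x)
  (hmq : ∀ x, haveI : Fact (pp : ℕ).Prime := ⟨pp.2⟩; ‖tq pp x‖ = ‖(ϖ x : (presAt X hlog pp).k x)‖ ^ mq x)

include ht0 ht1 hm0 hm1 houtΛ hdom hϖ hD hin hmax hRin hRout hMΘ hmq in
/-- **THE CELL SLACK OF THE SHARP SETTING AGAINST THE SHELL BUDGET PLUS TRANSFERS.** For ANY per-tuple common lower bounds `μ(v⃗) ≤ M_{v_a}/e_{v_a}`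
of the Θ-slot valuations: `logvol(ⁿ˒°𝒰_{i+1,p}) − qLocal_{i+1,p} ≤ Σ_{v⃗} Pr(v⃗)·(1 + Σ_a (D + R_in − R_out)(v_a)/e(v_a) + (m_{q,v_{i+1}}/e_{v_{i+1}} − μ(v⃗)))·log p`
(p481438 `cellSlack_settingPrVolSharp_eq` + §1 tuple by tuple, `Pr ≥ 0`). [cite: DupuyHilado2025, §3.7, §4.9, §4.12]
[cite: Mochizuki2012, IUTchIII Cor. 3.12 p. 173–175; IUTchIV Prop. 1.2 (i)(ii) p. 10, Prop. 1.4 (iii) p. 13–14] [claim: Mochizuki2012, status: disputed] -/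
theorem cellSlack_settingPrVolSharp_le_sum_shellBudget_add_transfer
    (μ : ((thetaIndex X).Caps (Setting.labelSucc i) → (thetaIndex X).Fibre (.inr pp)) → ℝ)
    (hμ : ∀ (e : (thetaIndex X).Caps (Setting.labelSucc i) → (thetaIndex X).Fibre (.inr pp)) (a : _),
      haveI : Fact (pp : ℕ).Prime := ⟨pp.2⟩; μ e ≤ (MΘ (e a) : ℝ) / absRamificationIdx pp.1 ((presAt X hlog pp).k (e a))) :
    haveI : Fact (pp : ℕ).Prime := ⟨pp.2⟩
    ((situationPrVol X hlog M archPk archSub Ψ act Mmod region).D n).logvol _ (.inr pp)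
          ((settingPrVolSharp X hlog M archPk archSub Ψ act Mmod region n lat sig split qData tq t htq0 htq1).thetaHull
            (Setting.labelSucc i) (.inr pp)) -
        (settingPrVolSharp X hlog M archPk archSub Ψ act Mmod region n lat sig split qData tq t htq0 htq1).qLocal
          (Setting.labelSucc i) (.inr pp) ≤
      ∑ e : (presAt X hlog pp).toLocalPieces.E (Setting.labelSucc i),
        weightPr X pp.1 (Setting.labelSucc i) e *
          ((1 + ∑ a, ((D (e a) : ℝ) + (Rin (e a) - Rout (e a))) / absRamificationIdx pp.1 ((presAt X hlog pp).k (e a)) +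
              ((mq (e (Fin.last _)) : ℝ) / absRamificationIdx pp.1 ((presAt X hlog pp).k (e (Fin.last _))) - μ e)) *
            Real.log pp) := by
  haveI : Fact (pp : ℕ).Prime := ⟨pp.2⟩
  haveI : Nonempty ((thetaIndex X).Caps (Setting.labelSucc i)) := ⟨0⟩
  rw [RHCellSlackExact.cellSlack_settingPrVolSharp_eq X hlog M archPk archSub Ψ act Mmod region n lat sig split qData t tq ht0 ht1
    htq0 htq1 i pp m hm0 hm1 houtΛ hdom]
  refine Finset.sum_le_sum fun e _ => mul_le_mul_of_nonneg_left ?_ (weightPr_nonneg X pp.1 _ e)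
  exact bracket_le_shellBudget_add_transfer pp.1 ((presAt X hlog pp).kk e) (fun a => ϖ (e a)) (fun a => hϖ (e a))
    (D := fun a => D (e a)) (fun a => hD (e a)) (cin := fun a => cin (e a)) (cout := fun a => cout (e a))
    (fun a => hin (e a)) (fun a => hmax (e a)) (Rin := fun a => Rin (e a)) (Rout := fun a => Rout (e a))
    (fun a => hRin (e a)) (fun a => hRout (e a)) (x := fun a => t pp i (e a)) (M := fun a => MΘ (e a))
    (fun a => hMΘ (e a)) (hm1 e) (Fin.last _) (hmq (e (Fin.last _))) (hμ e)

include ht0 ht1 hm0 hm1 houtΛ hdom hϖ hD hin hmax hRin hRout hMΘ hmq in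
/-- **DEEP SLOTS ⟹ NO TRANSFER.** If every Θ-slot of every tuple over `p` is at least as deep as the tuple's `q`-slot
(`m_{q,v_{i+1}}/e_{v_{i+1}} ≤ M_{v_a}/e_{v_a}`), then `logvol(ⁿ˒°𝒰_{i+1,p}) − qLocal_{i+1,p} ≤ Σ_{v⃗} Pr(v⃗)·(1 + Σ_a (D + R_in − R_out)(v_a)/e(v_a))·log p`.
[cite: DupuyHilado2025, §4.12] [cite: Mochizuki2012, IUTchIV Prop. 1.2 (i)(ii) p. 10] [claim: Mochizuki2012, status: disputed] -/
theorem cellSlack_settingPrVolSharp_le_sum_shellBudget_of_deep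
    (hdeep : ∀ (e : (thetaIndex X).Caps (Setting.labelSucc i) → (thetaIndex X).Fibre (.inr pp)) (a : _),
      haveI : Fact (pp : ℕ).Prime := ⟨pp.2⟩
      (mq (e (Fin.last _)) : ℝ) / absRamificationIdx pp.1 ((presAt X hlog pp).k (e (Fin.last _))) ≤
        (MΘ (e a) : ℝ) / absRamificationIdx pp.1 ((presAt X hlog pp).k (e a))) :
    haveI : Fact (pp : ℕ).Prime := ⟨pp.2⟩
    ((situationPrVol X hlog M archPk archSub Ψ act Mmod region).D n).logvol _ (.inr pp)
          ((settingPrVolSharp X hlog M archPk archSub Ψ act Mmod region n lat sig split qData tq t htq0 htq1).thetaHull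
            (Setting.labelSucc i) (.inr pp)) -
        (settingPrVolSharp X hlog M archPk archSub Ψ act Mmod region n lat sig split qData tq t htq0 htq1).qLocal
          (Setting.labelSucc i) (.inr pp) ≤
      ∑ e : (presAt X hlog pp).toLocalPieces.E (Setting.labelSucc i),
        weightPr X pp.1 (Setting.labelSucc i) e *
          ((1 + ∑ a, ((D (e a) : ℝ) + (Rin (e a) - Rout (e a))) / absRamificationIdx pp.1 ((presAt X hlog pp).k (e a))) *
            Real.log pp) := by
  haveI : Fact (pp : ℕ).Prime := ⟨pp.2⟩
  have h := cellSlack_settingPrVolSharp_le_sum_shellBudget_add_transfer X hlog M archPk archSub Ψ act Mmod region n lat sig split qData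
    t tq ht0 ht1 htq0 htq1 i pp m hm0 hm1 ϖ hϖ hD hin hmax houtΛ hdom hRin hRout hMΘ hmq
    (fun e => (mq (e (Fin.last _)) : ℝ) / absRamificationIdx pp.1 ((presAt X hlog pp).k (e (Fin.last _)))) hdeep
  simpa only [sub_self, add_zero] using h

include ht0 ht1 hm0 hm1 houtΛ hdom hϖ hD hin hmax hRin hRout hMΘ hmq in
/-- **THE PLACE-LEVEL (GLOBAL) FORM — «THE CREDIT IS CONDUCTOR-TYPE» AT THE SHARP SETTING.** Under the deep-slot condition,
`logvol(ⁿ˒°𝒰_{i+1,p}) − qLocal_{i+1,p} ≤ (1 + |S^±_{i+2}|·Σ_{v ∣ p} (n_v/[F:ℚ])·(D_v + R_in,v − R_out,v)/e_v)·log p` — the different plus the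
log-shell span of the places over `p`, `Pr`-weighted, once per slot, plus one floor loss; NO local height (`M`, `m_q` do not occur).
(§2 marginals + `Σ Pr = 1`.) [cite: DupuyHilado2025, §3.6, §4.12] [cite: Mochizuki2012, IUTchIV Prop. 1.2 (i)(ii) p. 10, Thm. 1.10 Step (v) p. 27–28]
[claim: Mochizuki2012, status: disputed] -/
theorem cellSlack_settingPrVolSharp_le_shellBudget_places_of_deep
    (hdeep : ∀ (e : (thetaIndex X).Caps (Setting.labelSucc i) → (thetaIndex X).Fibre (.inr pp)) (a : _),
      haveI : Fact (pp : ℕ).Prime := ⟨pp.2⟩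
      (mq (e (Fin.last _)) : ℝ) / absRamificationIdx pp.1 ((presAt X hlog pp).k (e (Fin.last _))) ≤
        (MΘ (e a) : ℝ) / absRamificationIdx pp.1 ((presAt X hlog pp).k (e a))) :
    haveI : Fact (pp : ℕ).Prime := ⟨pp.2⟩
    ((situationPrVol X hlog M archPk archSub Ψ act Mmod region).D n).logvol _ (.inr pp)
          ((settingPrVolSharp X hlog M archPk archSub Ψ act Mmod region n lat sig split qData tq t htq0 htq1).thetaHull
            (Setting.labelSucc i) (.inr pp)) -
        (settingPrVolSharp X hlog M archPk archSub Ψ act Mmod region n lat sig split qData tq t htq0 htq1).qLocal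
          (Setting.labelSucc i) (.inr pp) ≤
      (1 + Fintype.card ((thetaIndex X).Caps (Setting.labelSucc i)) *
          ∑ v : ↥(placesOver F pp), weight F v.1 *
            (((D ((fibreEquivPlacesOver X pp).symm v) : ℝ) +
                (Rin ((fibreEquivPlacesOver X pp).symm v) - Rout ((fibreEquivPlacesOver X pp).symm v))) /
              absRamificationIdx pp.1 ((presAt X hlog pp).k ((fibreEquivPlacesOver X pp).symm v)))) *
        Real.log pp := by
  haveI : Fact (pp : ℕ).Prime := ⟨pp.2⟩
  refine (cellSlack_settingPrVolSharp_le_sum_shellBudget_of_deep X hlog M archPk archSub Ψ act Mmod region n lat sig split qData t tq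
    ht0 ht1 htq0 htq1 i pp m hm0 hm1 ϖ hϖ hD hin hmax houtΛ hdom hRin hRout hMΘ hmq hdeep).trans (le_of_eq ?_)
  -- bookkeeping: `Σ Pr·((1 + Σ_a B(v_a))·log p) = (Σ Pr + Σ Pr·Σ_a B(v_a))·log p = (1 + |Caps|·Σ_v Pr(v)·B(v))·log p`
  set B : (thetaIndex X).Fibre (.inr pp) → ℝ := fun x =>
    ((D x : ℝ) + (Rin x - Rout x)) / absRamificationIdx pp.1 ((presAt X hlog pp).k x) with hB
  have h1 : ∀ e : (presAt X hlog pp).toLocalPieces.E (Setting.labelSucc i),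
      weightPr X pp.1 (Setting.labelSucc i) e * ((1 + ∑ a, B (e a)) * Real.log pp) =
        (weightPr X pp.1 (Setting.labelSucc i) e + weightPr X pp.1 (Setting.labelSucc i) e * ∑ a, B (e a)) * Real.log pp :=
    fun e => by ring
  rw [Finset.sum_congr rfl fun e _ => h1 e, ← Finset.sum_mul, Finset.sum_add_distrib,
    sum_weightPr_presAt X hlog pp (Setting.labelSucc i), sum_weightPr_mul_sum_apply X hlog pp (Setting.labelSucc i) B]

end Setting

end Summit.ABC.IUTFork.Repair.RHCreditShellBudgetSetting

end
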